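import Summits.QuantumFields.YangMills.Theorems.BalabanUVNodesN16Restr129
import Summits.QuantumFields.BalabanUV.T4Continuum.Spine.NE3.PairThm4AtB8
import HarnessLib

/-!
# Route «BalabanUVNodes» (cluster K4 «SpineRates»), Track-A DAG node N16 = NE3 — THE ASSEMBLY OF THE N05 INTERFACE FROM [B8] THEOREM 4's TYPED
# INTERFACE `Thm4At` AT THE PAIR BACKGROUNDS: `PairLandauGaugeB8Avg` ⇐ «`Thm4At` (Restr := (1.29) `Restr129`) at every `W = rescale L (bavg L U_B)`» ∧
# «`Reg W`» ∧ «the Concl-dictionary» ∧ N07's interface; then N16 with the constant of record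

Cell `pub-ymgap`, seat `pub-ymgap-dag-n16-a` (KNIT-BY-NAME, HUMAN RULING D-0062; chair R424 venue), generation 3, file 3.  `bears_on: R4∕N16`.  Filed
`--supports stmt-QuantumFields-19182` (`SpineGivenEndpoint`, K4).  The -a∕-b split of the roster: seat n16-b proves the members ([DAGN16B-G0-MAP-2],
[DAGN16B-G2-STAGED-1]: `PairThm4AtB8.concl_of_thm4At_minimisers`, `PairDbarB8.dbar_of_restr129_pair`, staged `PairReg335B8.concl_of_thm4At_minimisers_reg335`
and the coming Concl-dictionary); this file ASSEMBLES them BY NAME.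

THE ASSEMBLY (§1 `pairLandauGaugeB8Avg_of_thm4At`, any `d ≥ 1`).  HYPOTHESES, all typed SHAPES over the tree's concrete `ℤᵈ` carriers, asserted by nobody:
(T4) for every level `k ≥ 1`, [Balaban1985RegularSpaces] Theorem 4 p. 88 in the tree's typed interface `B8Eq119TwistedAxial.Thm4At L k (Lᵏ)⁻¹ c₁ (unitaryUnits)
(a k) (M k) (ρ k) (Reg k) (Restr129 L k (Λ k)) (Concl k)` — restriction (1.29) CONCRETE (`Restr129`, `Λ k k = univ`: the all-small-field torus), regularity
clause `Reg k` («(3.35) of [4]») and conclusion `Concl k` («(1.37), (1.38), (1.62) hold for U₁ = U′^{u⁻¹}») ABSTRACT; (REG) `Reg k W` at every pair background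
`W = rescale L (bavg L U_B)` (n16-b's staged F2 proves it for `Reg := B8Eq133Hypotheses.Reg335Zd …` from the (H3ˢᵘᵖ) letters — then this binder goes);
(DICT) THE CONCL-DICTIONARY: at every pair, for every unitary `u`, `Concl k α (11d²α) W U′ u` (`U′ = pert (U_A^{u₀}) W`, `u₀ = ptw L W U_A k` the pinned
axial pre-gauge) yields a Landau representative `(u_L, Z)` with `LandauRepB8 L N k W U_A u_L Z s₁ s₂ β` ((1.36)∕(1.38)∕(1.39) read at the pair, incl. the
[Balaban1985RegularSpaces] Prop 3 members `grad`∕`holder`) AND the transition-gauge equation `(W·e^{Z})^{u} = U_A^{u₀}` — n16-b's NEXT («left-chart ↔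
END-frame dictionary for Thm 4's (1.62)∕(1.36) output letters»); (H3ˢᵘᵖ) N07's interface `LeafH3sup d L N ε b′ c′ dom`; letters: class radius `ε`, class
regularity `b` (with `512(d+1)(d+4)L²b ≤ 1`, `b + 226(8(d+1)(d+4))²b² < α`), sup letters `(b′, c′)` with (Rb), `b′ ≤ 1`, `b′ + 226(8(d+1)(d+4))²b′² < α`,
`4(d−1)(c′ + curConst·b′²) < α`, and ONE letter `α` with `ε < α`, `C₀α ≤ ⅓`, `2α ≤ c₂′`, `11d²α ≤ 1∕6`, `α + 11d²α ≤ c₁`.  CONCLUSION: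
`PairLandauGaugeB8Avg d (sfClass d L N ε) L N b g s₁ s₂ β dom` — per pair: (H3ˢᵘᵖ) makes both minimisers `RegularSup b′ c′`; n16-b's capstone
`concl_of_thm4At_minimisers` applies (T4) at `(W, U_A)` (its 𝔄_k, axial, (1.66) binders kernel-supplied) giving the unique `u` with `Restr129 … W u` and
`Concl …`; (DICT) gives `(u_L, Z)`; file 2's `dbar_of_restr129_pair` gives (1.37).  Uniqueness is not used.
§2 `n16_of_thm4At` (`d = 4`): (T4) with constant `c₁ > 0` ∧ (REG) ∧ (DICT) ∧ (H3ˢᵘᵖ) ⟹ N16 with the CONSTANT OF RECORD — `∃ r > 0, ∀ g > 0, ∃ C ≥ 0,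
∀ b′ c′` on FOUR ε-free leaf lines ((Rb), the `c′`-line, and the two new ones against the DISPLAYED absolute letter
`α⋆ = min {1∕(3C₀(4)), c₂′(4,L)∕2, 1∕1056, c₁∕177}`), `∀ 0 < ε ≤ r, 0 ≤ s₁ ≤ r, 0 ≤ b ≤ ε∕2, ∀ s₂`, families, `dom`: … ⟹
`NE3EnergyRateWCov 4 (sfClass 4 L N ε) L N b g C s₁ s₂ dom` (file 1's `n16_constant_of_record`, `r` shrunk by five closed radii).
§3 `ne3Shape_of_thm4At` (`d = 4`): the DECL column likewise — g2's `ne3Shape_of_inEdges` with N05 replaced by (T4) ∧ (REG) ∧ (DICT).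

HONEST FRAMING.  Bookkeeping over LANDED theorems by name; nothing of Bałaban's is asserted; (T4) = [Balaban1985RegularSpaces] Thm 4 TYPE at curved
backgrounds — NOT proved anywhere in the tree; (REG), (DICT), (H3ˢᵘᵖ) are binders; **N16 ∕ NE3 is NOT discharged**; NODE 00 has not pinned NE3's carriers;
count-neutral; one finite four-torus at fixed ε — NOT ℝ⁴, NOT infinite volume, NOT OS, NOT a mass gap, NOT Clay.
-/

set_option autoImplicit false

open scoped BigOperators Matrix Matrix.Norms.L2Operator
open NormedSpace

namespace Summit.QuantumFields.YangMills.BalabanUVNodes.N16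

open Literature.MathematicalPhysics.QuantumFieldTheory.Balaban1983to89
open B7Prop1Explicit B7Prop2Explicit
open T4AveragingDeficitWall (vary fineAction blockSites)
open T4AveragingDeficitWallBoundary (periodBox)
open T4EtaRateMin (NE3Shape)
open B8Lemma1NonAbelian (pert)
open B8Eq119TwistedAxial (Thm4At Restr129)
open B8Eq166ConstraintPair (ptw)
open Summit.QuantumFields.BalabanUV.T4Continuum
open MinimalActionSandwich (IsMinimiser)
open MinimalActionRate (Regular sfClass minActReadings)
open MinimalActionRefine (RegularSup gradConst)
open BlockAverageCurrent (curConst curConst_nonneg)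
open NE3EnergyWeightedCovShape (NE3EnergyRateWCov)
open NE3RightInverseSupLetters (frameC)
open NE3.PairLandauB8 (LandauRepB8)
open NE3.PairLandauB8Avg (PairLandauGaugeB8Avg)
open NE3.LeafIndexSockets (LeafH3sup)
open NE3.PairDbarB8 (dbar_of_restr129_pair)
open NE3.PairThm4AtB8 (concl_of_thm4At_minimisers)

noncomputable section

variable {d : ℕ} {n : Type*} [Fintype n] [DecidableEq n]

/-! ## §1 The assembly at any dimension -/

/-- **`PairLandauGaugeB8Avg` ASSEMBLED FROM [B8] THM 4's TYPED INTERFACE AT THE PAIR BACKGROUNDS** (`d ≥ 1`, `L ≥ 2`; letters as in the module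
docstring).  (T4) `hT4` ∧ (REG) `hReg` ∧ (DICT) `hdict` ∧ (H3ˢᵘᵖ) `h3` ⟹ `PairLandauGaugeB8Avg d (sfClass d L N ε) L N b g s₁ s₂ β dom` — n16-b's
`concl_of_thm4At_minimisers` ∘ `hdict` ∘ file 2's `dbar_of_restr129_pair`.  No existence is proved: (T4) is Theorem 4 TYPE, a hypothesis. [folklore] -/
theorem pairLandauGaugeB8Avg_of_thm4At [Nonempty n] (hd : 1 ≤ d) {L N : ℕ} (hL : 2 ≤ L) {ε b g b' c' α c₁ s₁ s₂ β : ℝ}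
    (hε : 0 ≤ ε) (hb : 0 ≤ b) (hbs : 512 * (d + 1) * (d + 4) * (L : ℝ) ^ 2 * b ≤ 1)
    (hbα : b + 226 * (8 * (d + 1) * (d + 4)) ^ 2 * b ^ 2 < α)
    (hb' : 0 ≤ b') (hc' : 0 ≤ c') (hb'1 : b' ≤ 1) (hRb : 2 ^ 15 * ((d : ℝ) + 1) ^ 2 * ((d : ℝ) + 4) ^ 2 * (L : ℝ) ^ 2 * b' ≤ 1)
    (hb'α : b' + 226 * (8 * (d + 1) * (d + 4)) ^ 2 * b' ^ 2 < α) (hc'α : 4 * ((d : ℝ) - 1) * (c' + curConst d L * b' ^ 2) < α)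
    (hα : 0 < α) (hεα : ε < α) (hα3 : C0 d * α ≤ 1 / 3) (hα2 : 2 * α ≤ c2' d L) (hsmall : 11 * (d : ℝ) ^ 2 * α ≤ 1 / 6)
    (hc₁ : α + 11 * (d : ℝ) ^ 2 * α ≤ c₁)
    {a : ℕ → Site d} {M ρ : ℕ → ℕ} {Reg : ℕ → (Site d → Fin d → (Matrix n n ℂ)ˣ) → Prop} {Λ : ℕ → ℕ → Set (Site d)}
    {Concl : ℕ → ℝ → ℝ → (Site d → Fin d → (Matrix n n ℂ)ˣ) → (Site d → Fin d → (Matrix n n ℂ)ˣ) → (Site d → (Matrix n n ℂ)ˣ) → Prop}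
    (hΛ : ∀ k, Λ k k = Set.univ)
    (hT4 : ∀ k, 1 ≤ k → Thm4At L k (((L : ℝ) ^ k)⁻¹) c₁ (unitaryUnits (Matrix n n ℂ)) (a k) (M k) (ρ k) (Reg k) (Restr129 L k (Λ k)) (Concl k))
    {dom : Set (Site d → Fin d → (Matrix n n ℂ)ˣ)}
    (hReg : ∀ k : ℕ, 1 ≤ k → ∀ V ∈ dom, ∀ UA UB : Site d → Fin d → (Matrix n n ℂ)ˣ,
      IsMinimiser d (sfClass d L N ε) L N k V UA → IsMinimiser d (sfClass d L N ε) L N (k + 1) V UB → Reg k (rescale L (bavg L UB)))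
    (hdict : ∀ k : ℕ, 1 ≤ k → ∀ V ∈ dom, ∀ UA UB : Site d → Fin d → (Matrix n n ℂ)ˣ,
      IsMinimiser d (sfClass d L N ε) L N k V UA → IsMinimiser d (sfClass d L N ε) L N (k + 1) V UB →
      ∀ u : Site d → (Matrix n n ℂ)ˣ, (∀ x, u x ∈ unitaryUnits (Matrix n n ℂ)) →
        Concl k α (11 * (d : ℝ) ^ 2 * α) (rescale L (bavg L UB))
          (pert (gaugeAct (ptw L (rescale L (bavg L UB)) UA k) UA) (rescale L (bavg L UB))) u →
        ∃ (uL : Site d → (Matrix n n ℂ)ˣ) (Z : Site d → Fin d → Matrix n n ℂ),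
          LandauRepB8 L N k (rescale L (bavg L UB)) UA uL Z s₁ s₂ β ∧
          gaugeAct u (vary (rescale L (bavg L UB)) Z 1) = gaugeAct (ptw L (rescale L (bavg L UB)) UA k) UA)
    (h3 : LeafH3sup d L N ε b' c' dom) :
    PairLandauGaugeB8Avg d (sfClass d L N ε) L N b g s₁ s₂ β dom := by
  intro k hk V hV UA UB hA hB hreg
  -- both minimisers are `RegularSup b′ c′` by (H3ˢᵘᵖ) (levels `k ≥ 1`, `k + 1`)
  obtain ⟨k', rfl⟩ : ∃ k', k = k' + 1 := ⟨k - 1, by omega⟩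
  have hregA : RegularSup d L N b' c' (k' + 1) UA := h3 V hV k' UA hA
  have hregB : RegularSup d L N b' c' (k' + 1 + 1) UB := h3 V hV (k' + 1) UB hB
  -- `b′ ∕ (Lᵏ)² ≤ ¼`
  have hL2 : (2 : ℝ) ≤ L := by exact_mod_cast hL
  have hb4 : b' / ((L : ℝ) ^ (k' + 1)) ^ 2 ≤ 1 / 4 := by
    have hLk : (2 : ℝ) ≤ (L : ℝ) ^ (k' + 1) := by
      calc (2 : ℝ) = 2 ^ 1 := by norm_num
        _ ≤ (L : ℝ) ^ 1 := by gcongr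
        _ ≤ (L : ℝ) ^ (k' + 1) := pow_le_pow_right₀ (by linarith) (by omega)
    have h4 : (4 : ℝ) ≤ ((L : ℝ) ^ (k' + 1)) ^ 2 := by nlinarith
    rw [div_le_div_iff₀ (by positivity) (by norm_num)]
    nlinarith
  -- Theorem 4's typed interface at the pair (n16-b's capstone): the unique `u` with (1.29) and `Concl`
  obtain ⟨u, ⟨hu, hres, hconcl⟩, -⟩ := concl_of_thm4At_minimisers hd hL hA hB hregA hregB hε hb' hc' hb4 hRb hα hεα hb'α hc'α hα3 hα2
    hsmall (hT4 (k' + 1) hk) hc₁ (hReg (k' + 1) hk V hV UA UB hA hB)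
  -- the Concl-dictionary: Landau representative + transition-gauge equation
  obtain ⟨uL, Z, hLR, htrans⟩ := hdict (k' + 1) hk V hV UA UB hA hB u hu hconcl
  -- (1.37) from (1.29) (file 2 ∕ n16-b)
  exact ⟨uL, Z, hLR, dbar_of_restr129_pair hd hL hA hB hreg hε hb hbs hα hεα hbα hα3 hα2 htrans (hΛ (k' + 1)) hres⟩

/-! ## §2 The `d = 4` knit: N16 with the constant of record from (T4) ∧ (REG) ∧ (DICT) ∧ (H3ˢᵘᵖ) -/

/-- **N16 · NE3 BY NAME FROM [B8] THM 4's TYPED INTERFACE AT THE PAIR BACKGROUNDS, ITS CONCL-DICTIONARY, AND N07's INTERFACE** (`d = 4`; `L ≥ 2`,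
`N ≥ 1`; Theorem 4's constant `c₁ > 0`).  With the DISPLAYED absolute letter `α⋆ = min {1∕(3C₀(4)), c₂′(4,L)∕2, 1∕1056, c₁∕177}`: there is `r > 0` (function of
`(L, N, n, c₁)`) such that for every `g > 0` there is ONE `C ≥ 0` (function of `(L, N, n, g)`) such that for all leaf letters `0 ≤ b′, c′` on FOUR ε-free lines —
(Rb) `2¹⁵·5²·8²·L²·b′ ≤ 1`, the `c′`-line `23040·4⁴·(frameC 4 L + 4)³·(c′ + curConst·b′²) ≤ 1`, `b′ + 226·320²·b′² < α⋆`, `12·(c′ + curConst·b′²) < α⋆` — every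
`0 < ε ≤ r`, `0 ≤ s₁ ≤ r`, `0 ≤ b ≤ ε∕2`, `s₂`, every families `(a, M, ρ, Reg, Λ, Concl)` with `Λ k k = univ`, every `dom`:
(T4) `∀ k ≥ 1, Thm4At L k (Lᵏ)⁻¹ c₁ unitaryUnits (a k) (M k) (ρ k) (Reg k) (Restr129 L k (Λ k)) (Concl k)` → (REG) → (DICT) at `(α⋆, s₁, s₂, β = 1)` →
`LeafH3sup 4 L N ε b′ c′ dom` → `NE3EnergyRateWCov 4 (sfClass 4 L N ε) L N b g C s₁ s₂ dom` (= `YMDAG.N16 L N ε b g C s₁ s₂ dom`).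
File 1's `n16_constant_of_record` ∘ §1 (`r` shrunk by `α⋆∕2` and file 2's four radii).  N16 ∕ NE3 NOT proved: (T4), (REG), (DICT), (H3ˢᵘᵖ) are the
hypotheses — (T4) is where [Balaban1985RegularSpaces] Thm 4 at curved backgrounds enters, by its typed name. [folklore] -/
theorem n16_of_thm4At [Nonempty n] {L N : ℕ} (hL : 2 ≤ L) (hN : 1 ≤ N) {c₁ : ℝ} (hc₁ : 0 < c₁) :
    ∃ r : ℝ, 0 < r ∧ ∀ ⦃g : ℝ⦄, 0 < g → ∃ C : ℝ, 0 ≤ C ∧ ∀ ⦃b' c' : ℝ⦄, 0 ≤ b' → 0 ≤ c' →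
      2 ^ 15 * ((4 : ℝ) + 1) ^ 2 * ((4 : ℝ) + 4) ^ 2 * (L : ℝ) ^ 2 * b' ≤ 1 →
      23040 * (4 : ℝ) ^ 4 * (frameC 4 L + 4) ^ 3 * (c' + curConst 4 L * b' ^ 2) ≤ 1 →
      b' + 226 * (8 * ((4 : ℝ) + 1) * ((4 : ℝ) + 4)) ^ 2 * b' ^ 2 < min (1 / (3 * C0 4)) (min (c2' 4 L / 2) (min (1 / 1056) (c₁ / 177))) →
      4 * ((4 : ℝ) - 1) * (c' + curConst 4 L * b' ^ 2) < min (1 / (3 * C0 4)) (min (c2' 4 L / 2) (min (1 / 1056) (c₁ / 177))) →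
      ∀ ⦃ε s₁ b : ℝ⦄, 0 < ε → ε ≤ r → 0 ≤ s₁ → s₁ ≤ r → 0 ≤ b → b ≤ ε / 2 → ∀ (s₂ : ℝ)
      (a : ℕ → Site 4) (M ρ : ℕ → ℕ) (Reg : ℕ → (Site 4 → Fin 4 → (Matrix n n ℂ)ˣ) → Prop) (Λ : ℕ → ℕ → Set (Site 4))
      (Concl : ℕ → ℝ → ℝ → (Site 4 → Fin 4 → (Matrix n n ℂ)ˣ) → (Site 4 → Fin 4 → (Matrix n n ℂ)ˣ) → (Site 4 → (Matrix n n ℂ)ˣ) → Prop),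
      (∀ k, Λ k k = Set.univ) →
      (∀ k, 1 ≤ k → Thm4At L k (((L : ℝ) ^ k)⁻¹) c₁ (unitaryUnits (Matrix n n ℂ)) (a k) (M k) (ρ k) (Reg k) (Restr129 L k (Λ k)) (Concl k)) →
      ∀ {dom : _root_.Set (Site 4 → Fin 4 → (Matrix n n ℂ)ˣ)},
        (∀ k : ℕ, 1 ≤ k → ∀ V ∈ dom, ∀ UA UB : Site 4 → Fin 4 → (Matrix n n ℂ)ˣ,
          IsMinimiser 4 (sfClass 4 L N ε) L N k V UA → IsMinimiser 4 (sfClass 4 L N ε) L N (k + 1) V UB → Reg k (rescale L (bavg L UB))) →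
        (∀ k : ℕ, 1 ≤ k → ∀ V ∈ dom, ∀ UA UB : Site 4 → Fin 4 → (Matrix n n ℂ)ˣ,
          IsMinimiser 4 (sfClass 4 L N ε) L N k V UA → IsMinimiser 4 (sfClass 4 L N ε) L N (k + 1) V UB →
          ∀ u : Site 4 → (Matrix n n ℂ)ˣ, (∀ x, u x ∈ unitaryUnits (Matrix n n ℂ)) →
            Concl k (min (1 / (3 * C0 4)) (min (c2' 4 L / 2) (min (1 / 1056) (c₁ / 177))))
              (11 * ((4 : ℕ) : ℝ) ^ 2 * min (1 / (3 * C0 4)) (min (c2' 4 L / 2) (min (1 / 1056) (c₁ / 177))))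
              (rescale L (bavg L UB)) (pert (gaugeAct (ptw L (rescale L (bavg L UB)) UA k) UA) (rescale L (bavg L UB))) u →
            ∃ (uL : Site 4 → (Matrix n n ℂ)ˣ) (Z : Site 4 → Fin 4 → Matrix n n ℂ),
              LandauRepB8 L N k (rescale L (bavg L UB)) UA uL Z s₁ s₂ 1 ∧
              gaugeAct u (vary (rescale L (bavg L UB)) Z 1) = gaugeAct (ptw L (rescale L (bavg L UB)) UA k) UA) →
        LeafH3sup 4 L N ε b' c' dom →
        NE3EnergyRateWCov 4 (sfClass 4 L N ε) L N b g C s₁ s₂ dom := by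
  have hL1 : 1 ≤ L := by omega
  obtain ⟨r, hr0, hr⟩ := n16_constant_of_record (n := n) hL hN
  -- the displayed absolute letter `α⋆`
  set α : ℝ := min (1 / (3 * C0 4)) (min (c2' 4 L / 2) (min (1 / 1056) (c₁ / 177))) with hαdef
  have hC0 : 0 < C0 4 := C0_pos 4
  have hc2 : 0 < c2' 4 L := c2'_pos 4 L hL1
  have hα0 : 0 < α := lt_min (by positivity) (lt_min (by positivity) (lt_min (by norm_num) (by positivity)))
  have hα1 : α ≤ 1 / (3 * C0 4) := min_le_left _ _
  have hα2' : α ≤ c2' 4 L / 2 := (min_le_right _ _).trans (min_le_left _ _)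
  have hα3' : α ≤ 1 / 1056 := (min_le_right _ _).trans ((min_le_right _ _).trans (min_le_left _ _))
  have hα4' : α ≤ c₁ / 177 := (min_le_right _ _).trans ((min_le_right _ _).trans (min_le_right _ _))
  -- file 2's four radii at `d = 4`
  obtain ⟨R₁, hR₁⟩ : ∃ R : ℝ, R = 1 / (6 * C0 4 + 1) := ⟨_, rfl⟩
  obtain ⟨R₃, hR₃⟩ : ∃ R : ℝ, R = 1 / (226 * (8 * ((4 : ℝ) + 1) * ((4 : ℝ) + 4)) ^ 2 + 1) := ⟨_, rfl⟩
  obtain ⟨R₄, hR₄⟩ : ∃ R : ℝ, R = 1 / (256 * ((4 : ℝ) + 1) * ((4 : ℝ) + 4) * (L : ℝ) ^ 2 + 1) := ⟨_, rfl⟩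
  have hR₁0 : 0 < R₁ := by rw [hR₁]; positivity
  have hR₃0 : 0 < R₃ := by rw [hR₃]; positivity
  have hR₄0 : 0 < R₄ := by rw [hR₄]; positivity
  refine ⟨min r (min (α / 2) (min R₁ (min (c2' 4 L / 4) (min R₃ R₄)))),
    lt_min hr0 (lt_min (by positivity) (lt_min hR₁0 (lt_min (by positivity) (lt_min hR₃0 hR₄0)))), fun g hg => ?_⟩
  obtain ⟨C, hC0', hC⟩ := hr hg
  refine ⟨C, hC0', fun b' c' hb' hc' hRb hcF hb'α hc'α ε s₁ b hε hεr hs₁ hs₁r hb hbh s₂ a M ρ Reg Λ Concl hΛ hT4 dom hReg hdict h3 => ?_⟩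
  have hεr' : ε ≤ r := hεr.trans (min_le_left _ _)
  have hεα2 : ε ≤ α / 2 := hεr.trans ((min_le_right _ _).trans (min_le_left _ _))
  have hε1 : ε ≤ R₁ := hεr.trans ((min_le_right _ _).trans ((min_le_right _ _).trans (min_le_left _ _)))
  have hε2 : ε ≤ c2' 4 L / 4 := hεr.trans ((min_le_right _ _).trans ((min_le_right _ _).trans ((min_le_right _ _).trans (min_le_left _ _))))
  have hε3 : ε ≤ R₃ :=
    hεr.trans ((min_le_right _ _).trans ((min_le_right _ _).trans ((min_le_right _ _).trans ((min_le_right _ _).trans (min_le_left _ _)))))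
  have hε4 : ε ≤ R₄ :=
    hεr.trans ((min_le_right _ _).trans ((min_le_right _ _).trans ((min_le_right _ _).trans ((min_le_right _ _).trans (min_le_right _ _)))))
  have hs₁r' : s₁ ≤ r := hs₁r.trans (min_le_left _ _)
  have h1 : (6 * C0 4 + 1) * ε ≤ 1 := by
    rw [hR₁, le_div_iff₀ (by positivity)] at hε1; linarith
  have h2 : 4 * ε ≤ c2' 4 L := by linarith
  have h3' : (226 * (8 * (((4 : ℕ) : ℝ) + 1) * (((4 : ℕ) : ℝ) + 4)) ^ 2 + 1) * ε ≤ 1 := by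
    rw [hR₃, le_div_iff₀ (by positivity)] at hε3; push_cast; linarith
  have h4' : (256 * (((4 : ℕ) : ℝ) + 1) * (((4 : ℕ) : ℝ) + 4) * (L : ℝ) ^ 2 + 1) * ε ≤ 1 := by
    rw [hR₄, le_div_iff₀ (by positivity)] at hε4; push_cast; linarith
  -- the class letter `b` and the class radius against `α`
  obtain ⟨-, -, hbα2, -, -, hbs⟩ := restrRegime_of_small 4 L hε hb hbh h1 h2 h3' h4'
  have hεα : ε < α := by linarith
  have hbα : b + 226 * (8 * ((4 : ℕ) + 1 : ℝ) * ((4 : ℕ) + 4 : ℝ)) ^ 2 * b ^ 2 < α := by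
    have : b + 226 * (8 * ((4 : ℕ) + 1 : ℝ) * ((4 : ℕ) + 4 : ℝ)) ^ 2 * b ^ 2 < 2 * ε := by simpa using hbα2
    linarith
  -- the absolute lines of `α`
  have hA3 : C0 4 * α ≤ 1 / 3 := by
    rw [le_div_iff₀ (by positivity)] at hα1; linarith
  have hA2 : 2 * α ≤ c2' 4 L := by linarith
  have hAs : 11 * (((4 : ℕ) : ℝ)) ^ 2 * α ≤ 1 / 6 := by norm_num; linarith
  have hAc : α + 11 * (((4 : ℕ) : ℝ)) ^ 2 * α ≤ c₁ := by norm_num; linarith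
  -- the sup letters' lines
  have hb'1 : b' ≤ 1 := by
    have hL1r : (1 : ℝ) ≤ L := by exact_mod_cast hL1
    have hL2 : (1 : ℝ) ≤ (L : ℝ) ^ 2 := one_le_pow₀ hL1r
    nlinarith
  have hRb' : 2 ^ 15 * ((((4 : ℕ) : ℝ)) + 1) ^ 2 * ((((4 : ℕ) : ℝ)) + 4) ^ 2 * (L : ℝ) ^ 2 * b' ≤ 1 := by simpa only [Nat.cast_ofNat] using hRb
  have hb'α' : b' + 226 * (8 * ((4 : ℕ) + 1 : ℝ) * ((4 : ℕ) + 4 : ℝ)) ^ 2 * b' ^ 2 < α := by simpa using hb'α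
  have hc'α' : 4 * ((((4 : ℕ) : ℝ)) - 1) * (c' + curConst 4 L * b' ^ 2) < α := by simpa only [Nat.cast_ofNat] using hc'α
  exact hC hb' hc' hRb hcF hε hεr' hs₁ hs₁r' hb hbh s₂
    (pairLandauGaugeB8Avg_of_thm4At (by norm_num) hL hε.le hb hbs hbα hb' hc' hb'1 hRb' hb'α' hc'α' hα0 hεα hA3 hA2 hAs hAc hΛ hT4 hReg hdict h3) h3

/-! ## §3 The DECL column: `NE3Shape` at Bałaban's readings from (T4) ∧ (REG) ∧ (DICT) ∧ (H3ˢᵘᵖ) -/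

set_option maxHeartbeats 400000 in
/-- **N16 · THE ROW's DECL `T4EtaRateMin.NE3Shape` FROM [B8] THM 4's TYPED INTERFACE AT THE PAIR BACKGROUNDS** (`d = 4`; `L ≥ 2`, `N ≥ 1`; Thm 4's
constant `c₁ > 0`, `α⋆` as in §2) — g2's `BalabanUVNodesN16ShapeKnit.ne3Shape_of_inEdges` (its numeric regime verbatim, `r` shrunk by `α⋆∕2` and file 2's four
radii; N05's regularity letter `g := gradConst 4 c`) with the N05 interface REPLACED by (T4) ∧ (REG) ∧ (DICT) (at `(α⋆, s₁, s₂, β = 1)`) and the two new ε-free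
leaf lines on `(b, c)` against `α⋆`; (H3ˢᵘᵖ) `LeafH3sup 4 L N ε b c dom`.  CONCLUSION verbatim: a regular selection of minimisers exists and for every such
selection `∃ C′ ≥ 0, NE3Shape (minActReadings 4 (sfClass 4 L N ε) L N dom loc_D) C′ (L⁻¹)`.  §1 ∘ g2.  N16 ∕ NE3 NOT proved. [folklore] -/
theorem ne3Shape_of_thm4At [Nonempty n] {L N : ℕ} (hL : 2 ≤ L) (hN : 1 ≤ N) {c₁ : ℝ} (hc₁ : 0 < c₁) :
    ∃ r : ℝ, 0 < r ∧ ∀ ⦃ε s₁ t b c ε₁ : ℝ⦄, 0 < ε → ε ≤ r → 0 ≤ s₁ → s₁ ≤ r →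
      0 ≤ b → b ≤ t → 0 < c → c ≤ t →
      (2 : ℝ) ^ 91 * (L : ℝ) ^ 17 * t ≤ 1 → (2 : ℝ) ^ 76 * (L : ℝ) ^ 12 * t ≤ ε →
      16 * C0 4 * ε ≤ 3 → 1024 * (4 + 1) * (4 + 4) * (L : ℝ) ^ 2 * ε ≤ 1 → b ≤ ε / 2 →
      23040 * (4 : ℝ) ^ 4 * (frameC 4 L + 4) ^ 3 * (c + curConst 4 L * b ^ 2) ≤ 1 →
      b + 226 * (8 * ((4 : ℝ) + 1) * ((4 : ℝ) + 4)) ^ 2 * b ^ 2 < min (1 / (3 * C0 4)) (min (c2' 4 L / 2) (min (1 / 1056) (c₁ / 177))) →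
      4 * ((4 : ℝ) - 1) * (c + curConst 4 L * b ^ 2) < min (1 / (3 * C0 4)) (min (c2' 4 L / 2) (min (1 / 1056) (c₁ / 177))) →
      ε₁ ≤ 1 / 4 → ε₁ ≤ b → 4 * ε₁ ≤ c → ∀ (s₂ : ℝ)
      (a : ℕ → Site 4) (M ρ : ℕ → ℕ) (Reg : ℕ → (Site 4 → Fin 4 → (Matrix n n ℂ)ˣ) → Prop) (Λ : ℕ → ℕ → Set (Site 4))
      (Concl : ℕ → ℝ → ℝ → (Site 4 → Fin 4 → (Matrix n n ℂ)ˣ) → (Site 4 → Fin 4 → (Matrix n n ℂ)ˣ) → (Site 4 → (Matrix n n ℂ)ˣ) → Prop),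
      (∀ k, Λ k k = Set.univ) →
      (∀ k, 1 ≤ k → Thm4At L k (((L : ℝ) ^ k)⁻¹) c₁ (unitaryUnits (Matrix n n ℂ)) (a k) (M k) (ρ k) (Reg k) (Restr129 L k (Λ k)) (Concl k)) →
      ∀ {dom : Set (Site 4 → Fin 4 → (Matrix n n ℂ)ˣ)}, dom ⊆ sfClass 4 L N ε₁ 0 →
        (∀ k : ℕ, 1 ≤ k → ∀ V ∈ dom, ∀ UA UB : Site 4 → Fin 4 → (Matrix n n ℂ)ˣ,
          IsMinimiser 4 (sfClass 4 L N ε) L N k V UA → IsMinimiser 4 (sfClass 4 L N ε) L N (k + 1) V UB → Reg k (rescale L (bavg L UB))) →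
        (∀ k : ℕ, 1 ≤ k → ∀ V ∈ dom, ∀ UA UB : Site 4 → Fin 4 → (Matrix n n ℂ)ˣ,
          IsMinimiser 4 (sfClass 4 L N ε) L N k V UA → IsMinimiser 4 (sfClass 4 L N ε) L N (k + 1) V UB →
          ∀ u : Site 4 → (Matrix n n ℂ)ˣ, (∀ x, u x ∈ unitaryUnits (Matrix n n ℂ)) →
            Concl k (min (1 / (3 * C0 4)) (min (c2' 4 L / 2) (min (1 / 1056) (c₁ / 177))))
              (11 * ((4 : ℕ) : ℝ) ^ 2 * min (1 / (3 * C0 4)) (min (c2' 4 L / 2) (min (1 / 1056) (c₁ / 177))))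
              (rescale L (bavg L UB)) (pert (gaugeAct (ptw L (rescale L (bavg L UB)) UA k) UA) (rescale L (bavg L UB))) u →
            ∃ (uL : Site 4 → (Matrix n n ℂ)ˣ) (Z : Site 4 → Fin 4 → Matrix n n ℂ),
              LandauRepB8 L N k (rescale L (bavg L UB)) UA uL Z s₁ s₂ 1 ∧
              gaugeAct u (vary (rescale L (bavg L UB)) Z 1) = gaugeAct (ptw L (rescale L (bavg L UB)) UA k) UA) →
        LeafH3sup 4 L N ε b c dom →
        (∃ sel : ℕ → (Site 4 → Fin 4 → (Matrix n n ℂ)ˣ) → (Site 4 → Fin 4 → (Matrix n n ℂ)ˣ),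
            ∀ V ∈ dom, ∀ k : ℕ, IsMinimiser 4 (sfClass 4 L N ε) L N k V (sel k V) ∧ RegularSup 4 L N b c k (sel k V)) ∧
        ∀ sel : ℕ → (Site 4 → Fin 4 → (Matrix n n ℂ)ˣ) → (Site 4 → Fin 4 → (Matrix n n ℂ)ˣ),
          (∀ V ∈ dom, ∀ k : ℕ, IsMinimiser 4 (sfClass 4 L N ε) L N k V (sel k V)) →
          (∀ V ∈ dom, ∀ k : ℕ, RegularSup 4 L N b c k (sel k V)) →
          ∃ C' : ℝ, 0 ≤ C' ∧
            NE3Shape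
              (minActReadings 4 (sfClass 4 L N ε) L N dom
                (fun k V (x : ↥(periodBox (d := 4) N)) =>
                  fineAction (sel k V) (((blockSites L)^[k] {(x : Site 4)}) ×ˢ Finset.univ)))
              C' ((L : ℝ)⁻¹) := by
  have hL1 : 1 ≤ L := by omega
  obtain ⟨r, hr0, hr⟩ := ne3Shape_of_inEdges (n := n) hL hN
  set α : ℝ := min (1 / (3 * C0 4)) (min (c2' 4 L / 2) (min (1 / 1056) (c₁ / 177))) with hαdef
  have hC0 : 0 < C0 4 := C0_pos 4
  have hc2 : 0 < c2' 4 L := c2'_pos 4 L hL1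
  have hα0 : 0 < α := lt_min (by positivity) (lt_min (by positivity) (lt_min (by norm_num) (by positivity)))
  have hα1 : α ≤ 1 / (3 * C0 4) := min_le_left _ _
  have hα2' : α ≤ c2' 4 L / 2 := (min_le_right _ _).trans (min_le_left _ _)
  have hα3' : α ≤ 1 / 1056 := (min_le_right _ _).trans ((min_le_right _ _).trans (min_le_left _ _))
  have hα4' : α ≤ c₁ / 177 := (min_le_right _ _).trans ((min_le_right _ _).trans (min_le_right _ _))
  obtain ⟨R₁, hR₁⟩ : ∃ R : ℝ, R = 1 / (6 * C0 4 + 1) := ⟨_, rfl⟩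
  obtain ⟨R₃, hR₃⟩ : ∃ R : ℝ, R = 1 / (226 * (8 * ((4 : ℝ) + 1) * ((4 : ℝ) + 4)) ^ 2 + 1) := ⟨_, rfl⟩
  obtain ⟨R₄, hR₄⟩ : ∃ R : ℝ, R = 1 / (256 * ((4 : ℝ) + 1) * ((4 : ℝ) + 4) * (L : ℝ) ^ 2 + 1) := ⟨_, rfl⟩
  have hR₁0 : 0 < R₁ := by rw [hR₁]; positivity
  have hR₃0 : 0 < R₃ := by rw [hR₃]; positivity
  have hR₄0 : 0 < R₄ := by rw [hR₄]; positivity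
  refine ⟨min r (min (α / 2) (min R₁ (min (c2' 4 L / 4) (min R₃ R₄)))),
    lt_min hr0 (lt_min (by positivity) (lt_min hR₁0 (lt_min (by positivity) (lt_min hR₃0 hR₄0)))),
    fun ε s₁ t b c ε₁ hε hεr hs₁ hs₁r hb hbt hc hct hsmall hεt hε1 hε2 hbε hcF hbα' hcα' hε₁ hε₁b hε₁c s₂ a M ρ Reg Λ Concl hΛ hT4 dom hdom hReg hdict h3 => ?_⟩
  have hεr' : ε ≤ r := hεr.trans (min_le_left _ _)
  have hεα2 : ε ≤ α / 2 := hεr.trans ((min_le_right _ _).trans (min_le_left _ _))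
  have hεR1 : ε ≤ R₁ := hεr.trans ((min_le_right _ _).trans ((min_le_right _ _).trans (min_le_left _ _)))
  have hεR2 : ε ≤ c2' 4 L / 4 := hεr.trans ((min_le_right _ _).trans ((min_le_right _ _).trans ((min_le_right _ _).trans (min_le_left _ _))))
  have hεR3 : ε ≤ R₃ :=
    hεr.trans ((min_le_right _ _).trans ((min_le_right _ _).trans ((min_le_right _ _).trans ((min_le_right _ _).trans (min_le_left _ _)))))
  have hεR4 : ε ≤ R₄ :=
    hεr.trans ((min_le_right _ _).trans ((min_le_right _ _).trans ((min_le_right _ _).trans ((min_le_right _ _).trans (min_le_right _ _)))))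
  have hs₁r' : s₁ ≤ r := hs₁r.trans (min_le_left _ _)
  have h1 : (6 * C0 4 + 1) * ε ≤ 1 := by
    rw [hR₁, le_div_iff₀ (by positivity)] at hεR1; linarith
  have h2 : 4 * ε ≤ c2' 4 L := by linarith
  have h3' : (226 * (8 * (((4 : ℕ) : ℝ) + 1) * (((4 : ℕ) : ℝ) + 4)) ^ 2 + 1) * ε ≤ 1 := by
    rw [hR₃, le_div_iff₀ (by positivity)] at hεR3; push_cast; linarith
  have h4' : (256 * (((4 : ℕ) : ℝ) + 1) * (((4 : ℕ) : ℝ) + 4) * (L : ℝ) ^ 2 + 1) * ε ≤ 1 := by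
    rw [hR₄, le_div_iff₀ (by positivity)] at hεR4; push_cast; linarith
  -- the class letter `b` (here = the sup letter) and the class radius against `α`
  obtain ⟨-, -, hbα2, -, -, hbs⟩ := restrRegime_of_small 4 L hε hb hbε h1 h2 h3' h4'
  have hεα : ε < α := by linarith
  have hbα : b + 226 * (8 * ((4 : ℕ) + 1 : ℝ) * ((4 : ℕ) + 4 : ℝ)) ^ 2 * b ^ 2 < α := by
    have : b + 226 * (8 * ((4 : ℕ) + 1 : ℝ) * ((4 : ℕ) + 4 : ℝ)) ^ 2 * b ^ 2 < 2 * ε := by simpa using hbα2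
    linarith
  have hA3 : C0 4 * α ≤ 1 / 3 := by
    rw [le_div_iff₀ (by positivity)] at hα1; linarith
  have hA2 : 2 * α ≤ c2' 4 L := by linarith
  have hAs : 11 * (((4 : ℕ) : ℝ)) ^ 2 * α ≤ 1 / 6 := by norm_num; linarith
  have hAc : α + 11 * (((4 : ℕ) : ℝ)) ^ 2 * α ≤ c₁ := by norm_num; linarith
  -- the sup letters' lines ((Rb) from the numeral, as in g2's knit)
  have hL1r : (1 : ℝ) ≤ L := by exact_mod_cast hL1
  have hRb0 : 2 ^ 15 * ((4 : ℝ) + 1) ^ 2 * ((4 : ℝ) + 4) ^ 2 * (L : ℝ) ^ 2 * b ≤ 1 := by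
    have h2 : (L : ℝ) ^ 2 ≤ (L : ℝ) ^ 17 := pow_le_pow_right₀ hL1r (by norm_num)
    have e : 2 ^ 15 * ((4 : ℝ) + 1) ^ 2 * ((4 : ℝ) + 4) ^ 2 * (L : ℝ) ^ 2 * b = 52428800 * ((L : ℝ) ^ 2 * b) := by ring
    rw [e]
    have h5 : (L : ℝ) ^ 2 * b ≤ (L : ℝ) ^ 17 * t := mul_le_mul h2 hbt hb (by positivity)
    have h6 : (2 : ℝ) ^ 91 * ((L : ℝ) ^ 17 * t) ≤ 1 := by linarith [hsmall]
    have h7 : 0 ≤ (L : ℝ) ^ 17 * t := le_trans (by positivity) h5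
    linarith [h5, h6, h7]
  have hb1 : b ≤ 1 := by
    have hL2 : (1 : ℝ) ≤ (L : ℝ) ^ 2 := one_le_pow₀ hL1r
    nlinarith
  have hRb : 2 ^ 15 * ((((4 : ℕ) : ℝ)) + 1) ^ 2 * ((((4 : ℕ) : ℝ)) + 4) ^ 2 * (L : ℝ) ^ 2 * b ≤ 1 := by
    simpa only [Nat.cast_ofNat] using hRb0
  have hcα'' : 4 * ((((4 : ℕ) : ℝ)) - 1) * (c + curConst 4 L * b ^ 2) < α := by simpa only [Nat.cast_ofNat] using hcα'
  have hbα'' : b + 226 * (8 * ((4 : ℕ) + 1 : ℝ) * ((4 : ℕ) + 4 : ℝ)) ^ 2 * b ^ 2 < α := by simpa using hbα'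
  exact hr hε hεr' hs₁ hs₁r' hb hbt hc hct hsmall hεt hε1 hε2 hbε hcF hε₁ hε₁b hε₁c s₂ hdom
    (pairLandauGaugeB8Avg_of_thm4At (by norm_num) hL hε.le hb hbs hbα hb hc.le hb1 hRb hbα'' hcα'' hα0 hεα hA3 hA2 hAs hAc hΛ hT4 hReg hdict h3) h3

end

end Summit.QuantumFields.YangMills.BalabanUVNodes.N16
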